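import Mathlib
import Literature.Analysis.FluidPDE.VectorCalculus
import Literature.Analysis.FluidPDE.VorticityCalculus
import Literature.Analysis.FluidPDE.ClassicalSolution
import Literature.Analysis.FluidPDE.NSBoundedMildOseenClassical
import Summits.NavierStokesRegularity.NavierStokesRegularity.Theorems.UnthreadedDoorFluxStarvedDipoleDipolarWindowIrrotational
import Summits.NavierStokesRegularity.NavierStokesRegularity.Theorems.UnthreadedDoorAntidynamoStubsByName
import HarnessLib

/-!
# Route `UnthreadedDoor`, crux `PoloidalLiouville` (stmt-NavierStokesRegularity-1222), wall W1 — crux idea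
# «flux-starved-dipoles»: THE DIPOLE STRATUM OF THE WALL IS EMPTY (smooth dipole data)

The sketch's `DipoleStratumOfWall` (a W1-class flow — bounded ancient mild, measurable slices, smooth on `(−∞,0) × ℝ³` — whose
vorticity is coupled to a turning-axis DIPOLE toroidal potential at all times has constant slices) is composed from C2
(`dipolarWindowIrrotational`, p839296) and the antidynamo skeleton's stubs BY NAME (`stub_vorticityOfClass`,
`stub_potentialEvolution`, `stub_constantOfIrrotational`, all landed in `…AntidynamoStubsByName`).  The landed evolution stub
(E1) is stated for potentials SMOOTH on the punctured slab, so THIS FILE proves the version with SMOOTH dipole data `A, R` on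
`(−∞,0) × (0,∞)` (the sketch Prop asks only `C³`; otherwise VERBATIM):

* `curl_centre_eq_zero_of_dipoleCoupling` — under the dipole coupling off the centre, `curl v(t)(x₀) = 0` (continuity of the
  vorticity: along `±e` the coupled values are `±A(t,r) × e`);
* `dipoleStratumOfWall_smooth` — W1-class `v`, `A, R` jointly smooth, `curl v(t) = ∇T(t) × (x−x₀)` off `x₀` for the dipole
  potential ⇒ every slice `v(t)`, `t < 0`, is constant.

HONEST LABEL: the dipole (`l = 1`) stratum of W1 decided — information-grade (critic V28, W1 movement 0: it is the stratum where
the wall's conclusion was expected); `PoloidalLiouville` (1222), its wall `stub_scalarLiouville` (all `l`) and the summit stay OPEN;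
NO Navier–Stokes regularity statement is proved.  `--supports stmt-NavierStokesRegularity-1222` (helper).  [folklore]
-/

noncomputable section

-- the summit and its single sub-problem share the name (CONVENTIONS §1)
set_option linter.dupNamespace false

open Set Filter Topology InnerProductSpace MeasureTheory
open scoped RealInnerProductSpace Laplacian
open Literature.Analysis.FluidPDE
open Summit.NavierStokesRegularity.NavierStokesRegularity.Theorems.PoloidalLiouville.HorizonTower (E3)
open Summit.NavierStokesRegularity.NavierStokesRegularity.Theorems.PoloidalLiouville.KinematicShadow (PointSource.cross_smul_right
  PointSource.cross_add_right PointSource.cross_self PointSource.cross_anticomm)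
open Summit.NavierStokesRegularity.NavierStokesRegularity.Theorems.PoloidalLiouville.HorizonTower.Zonal (norm_cross_sq)

namespace Summit.NavierStokesRegularity.NavierStokesRegularity.Theorems.PoloidalLiouville.FluxStarvedDipole

/-- Under the dipole coupling, on the sphere `S_r(x₀)` the vorticity is `A(t,r) × ŷ`: for `‖e‖ = 1`, `r > 0`,
`∇T(x₀ + r e) × (r e) = A(r) × e`. [folklore] -/
theorem cross_gradient_dipole_sphere {A : ℝ → E3} {R : ℝ → ℝ} {x₀ : E3} {T : E3 → ℝ}
    (hT : ∀ z, T z = ⟪A ‖z - x₀‖, z - x₀⟫ / ‖z - x₀‖ + R ‖z - x₀‖)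
    (hA : ContDiffOn ℝ 3 A (Ioi 0)) (hR : ContDiffOn ℝ 3 R (Ioi 0)) {r : ℝ} (hr : 0 < r) {e : E3} (he : ‖e‖ = 1) :
    cross (gradient T (x₀ + r • e)) (r • e) = cross (A r) e := by
  have hy : ‖r • e‖ = r := by rw [norm_smul, he, mul_one, Real.norm_of_nonneg hr.le]
  obtain ⟨κ, hκ⟩ := dipole_gradient_sphere (x₀ := x₀) hT hA hR hr hy
  have cross_add_left' : ∀ a b c : E3, cross (a + b) c = cross a c + cross b c := fun a b c => by
    rw [← crossCLM_apply, ← crossCLM_apply, ← crossCLM_apply, map_add]; rfl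
  rw [hκ, cross_add_left', cross_smul_left, cross_smul_left, PointSource.cross_self, smul_zero, add_zero,
    PointSource.cross_smul_right, smul_smul, inv_mul_cancel₀ hr.ne', one_smul]

/-- **The vorticity vanishes at the centre** under the dipole coupling off the centre (`v(t) ∈ C¹`, `A(t,·), R(t,·) ∈ C³(0,∞)`):
along the rays `x₀ ± r e` the coupled vorticity is `±A(t,r) × e`, and both tend to `curl v(t)(x₀)`. [folklore] -/
theorem curl_centre_eq_zero_of_dipoleCoupling {u : E3 → E3} (hu : ContDiff ℝ 1 u) {x₀ : E3} {A : ℝ → E3} {R : ℝ → ℝ}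
    (hA : ContDiffOn ℝ 3 A (Ioi 0)) (hR : ContDiffOn ℝ 3 R (Ioi 0))
    (hcpl : ∀ x, x ≠ x₀ → curl u x = cross (gradient (fun x => ⟪A ‖x - x₀‖, x - x₀⟫ / ‖x - x₀‖ + R ‖x - x₀‖) x) (x - x₀)) :
    curl u x₀ = 0 := by
  set T : E3 → ℝ := fun x => ⟪A ‖x - x₀‖, x - x₀⟫ / ‖x - x₀‖ + R ‖x - x₀‖ with hTdef
  have hT : ∀ z, T z = ⟪A ‖z - x₀‖, z - x₀⟫ / ‖z - x₀‖ + R ‖z - x₀‖ := fun z => rfl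
  obtain ⟨e, he, -⟩ := NetFlux.exists_unit_orth (0 : E3)
  have hc : Continuous (curl u) := continuous_curl hu
  -- the two rays
  have hf : ∀ r : ℝ, 0 < r → curl u (x₀ + r • e) = cross (A r) e := by
    intro r hr
    have hne : x₀ + r • e ≠ x₀ := by
      intro h; have : r • e = 0 := by simpa using h
      rw [smul_eq_zero] at this
      rcases this with h1 | h1
      · exact hr.ne' h1
      · rw [h1, norm_zero] at he; exact zero_ne_one he
    rw [hcpl _ hne, add_sub_cancel_left]
    exact cross_gradient_dipole_sphere hT hA hR hr he
  have hg : ∀ r : ℝ, 0 < r → curl u (x₀ + r • (-e)) = -cross (A r) e := by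
    intro r hr
    have he' : ‖-e‖ = 1 := by rw [norm_neg, he]
    have hne : x₀ + r • (-e) ≠ x₀ := by
      intro h; have : r • (-e) = 0 := by simpa using h
      rw [smul_eq_zero] at this
      rcases this with h1 | h1
      · exact hr.ne' h1
      · rw [h1, norm_zero] at he'; exact zero_ne_one he'
    rw [hcpl _ hne, add_sub_cancel_left, cross_gradient_dipole_sphere hT hA hR hr he', ← crossCLM_apply, ← crossCLM_apply,
      map_neg]
  -- limits along the rays
  have hlim : ∀ w : E3, Tendsto (fun r : ℝ => curl u (x₀ + r • w)) (𝓝[>] 0) (𝓝 (curl u x₀)) := by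
    intro w
    have h1 : Tendsto (fun r : ℝ => x₀ + r • w) (𝓝 0) (𝓝 x₀) := by
      have : Continuous fun r : ℝ => x₀ + r • w := by fun_prop
      have h := this.tendsto 0
      simpa using h
    exact ((hc.tendsto x₀).comp h1).mono_left nhdsWithin_le_nhds
  have h1 : Tendsto (fun r : ℝ => cross (A r) e) (𝓝[>] 0) (𝓝 (curl u x₀)) :=
    (hlim e).congr' (eventually_nhdsWithin_of_forall fun r hr => hf r hr)
  have h2 : Tendsto (fun r : ℝ => -cross (A r) e) (𝓝[>] 0) (𝓝 (curl u x₀)) :=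
    (hlim (-e)).congr' (eventually_nhdsWithin_of_forall fun r hr => hg r hr)
  have h3 : Tendsto (fun r : ℝ => -cross (A r) e) (𝓝[>] 0) (𝓝 (-curl u x₀)) := h1.neg
  have heq : curl u x₀ = -curl u x₀ := tendsto_nhds_unique h2 h3
  have : (2 : ℝ) • curl u x₀ = 0 := by rw [two_smul]; nth_rewrite 2 [heq]; exact add_neg_cancel _
  rcases smul_eq_zero.mp this with h | h
  · exact absurd h two_ne_zero
  · exact h

/-- **THE DIPOLE STRATUM OF THE WALL IS EMPTY (smooth data)** — the sketch Prop `FluxStarvedDipole.DipoleStratumOfWall` with SMOOTH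
(instead of `C³`) dipole data, otherwise VERBATIM (`dipolePotentialT`, `dipolePotential` unfolded): a bounded ancient mild solution,
measurable slices, smooth on `(−∞,0) × ℝ³`, whose vorticity is `∇T(t) × (x − x₀)` off `x₀` for a turning-axis dipole potential with
`A, R` jointly smooth on `(−∞,0) × (0,∞)`, has CONSTANT slices.  Composition: `stub_vorticityOfClass` (vorticity formulation +
bound `K`), `curl_centre_eq_zero_of_dipoleCoupling`, `stub_potentialEvolution` ((E1) for the smooth potential), the moment bound
`‖A(t,r)‖ ≤ K` (vorticity on `S_r` is `A × ŷ`), C2 `dipolarWindowIrrotational` (`A ≡ 0`), hence `curl v ≡ 0`, and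
`stub_constantOfIrrotational`. [folklore] -/
theorem dipoleStratumOfWall_smooth :
    ∀ (v : ℝ → E3 → E3) (x₀ : E3) (A : ℝ → ℝ → E3) (R : ℝ → ℝ → ℝ),
      Literature.Analysis.FluidPDE.IsBoundedAncientMildSolution 1 v →
      (∀ t < 0, AEStronglyMeasurable (v t) volume) →
      ContDiffOn ℝ (⊤ : ℕ∞) (Function.uncurry v) (Set.Iio 0 ×ˢ Set.univ) →
      ContDiffOn ℝ (⊤ : ℕ∞) (Function.uncurry A) (Set.Iio 0 ×ˢ Set.Ioi 0) →
      ContDiffOn ℝ (⊤ : ℕ∞) (Function.uncurry R) (Set.Iio 0 ×ˢ Set.Ioi 0) →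
      (∀ t < 0, ∀ x, x ≠ x₀ →
        curl (v t) x = cross (gradient (fun x => ⟪A t ‖x - x₀‖, x - x₀⟫ / ‖x - x₀‖ + R t ‖x - x₀‖) x) (x - x₀)) →
      ∀ t < 0, ∃ b : E3, ∀ x, v t x = b := by
  intro v x₀ A R hB hmeas hsm hA hR hcpl
  obtain ⟨hVS, K, hK⟩ := Antidynamo.stub_vorticityOfClass v hB hmeas hsm
  have hA3 : ContDiffOn ℝ 3 (Function.uncurry A) (Set.Iio 0 ×ˢ Set.Ioi 0) := hA.of_le (by norm_cast)
  have hR3 : ContDiffOn ℝ 3 (Function.uncurry R) (Set.Iio 0 ×ˢ Set.Ioi 0) := hR.of_le (by norm_cast)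
  have hsm' : IsSmoothSpaceTimeOn (Iio 0) v := hsm
  have hv1 : ∀ t < 0, ContDiff ℝ 1 (v t) := fun t ht => (hsm'.contDiff_slice ht).of_le (by norm_cast)
  have hv2 : ∀ t ∈ Iio (0 : ℝ), ContDiff ℝ 2 (v t) := fun t ht => (hsm'.contDiff_slice ht).of_le (by norm_cast)
  have hdiv : ∀ t ∈ Iio (0 : ℝ), VectorCalculus.IsDivFree (v t) := fun t ht =>
    (hB.isAncientMildSolution.1 t ht).isDivFree_of_contDiff (hv1 t ht)
  -- the coupling everywhere (the vorticity vanishes at the centre)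
  have hAt : ∀ t < 0, ContDiffOn ℝ 3 (A t) (Ioi 0) := fun t ht => slice_contDiffOn_right hA3 ht
  have hRt : ∀ t < 0, ContDiffOn ℝ 3 (R t) (Ioi 0) := fun t ht => slice_contDiffOn_right hR3 ht
  set T : ℝ → E3 → ℝ := fun t x => ⟪A t ‖x - x₀‖, x - x₀⟫ / ‖x - x₀‖ + R t ‖x - x₀‖ with hTdef
  have hcpl' : ∀ t < 0, ∀ x, curl (v t) x = cross (gradient (T t) x) (x - x₀) := by
    intro t ht x
    by_cases hx : x = x₀
    · rw [hx, sub_self, ← crossCLM_apply, map_zero]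
      exact curl_centre_eq_zero_of_dipoleCoupling (hv1 t ht) (hAt t ht) (hRt t ht) (hcpl t ht)
    · exact hcpl t ht x hx
  -- the potential is smooth on the punctured slab
  have hTs : ContDiffOn ℝ (⊤ : ℕ∞) (Function.uncurry T) (Set.Iio 0 ×ˢ ({x₀}ᶜ : Set E3)) := by
    have hΦ : ContDiffOn ℝ (⊤ : ℕ∞) (fun p : ℝ × E3 => (p.1, ‖p.2 - x₀‖)) (Set.Iio 0 ×ˢ ({x₀}ᶜ : Set E3)) := by
      refine contDiffOn_fst.prodMk ?_
      intro p hp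
      have hne : p.2 - x₀ ≠ 0 := sub_ne_zero.mpr hp.2
      exact ((contDiffAt_snd.sub contDiffAt_const).norm ℝ hne).contDiffWithinAt
    have hmaps : Set.MapsTo (fun p : ℝ × E3 => (p.1, ‖p.2 - x₀‖)) (Set.Iio 0 ×ˢ ({x₀}ᶜ : Set E3))
        (Set.Iio 0 ×ˢ Set.Ioi 0) := fun p hp => ⟨hp.1, norm_pos_iff.mpr (sub_ne_zero.mpr hp.2)⟩
    have hAc := hA.comp hΦ hmaps
    have hRc := hR.comp hΦ hmaps
    have hsub : ContDiffOn ℝ (⊤ : ℕ∞) (fun p : ℝ × E3 => p.2 - x₀) (Set.Iio 0 ×ˢ ({x₀}ᶜ : Set E3)) :=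
      contDiffOn_snd.sub contDiffOn_const
    have hnorm : ContDiffOn ℝ (⊤ : ℕ∞) (fun p : ℝ × E3 => ‖p.2 - x₀‖) (Set.Iio 0 ×ˢ ({x₀}ᶜ : Set E3)) :=
      fun p hp => ((contDiffAt_snd.sub contDiffAt_const).norm ℝ (sub_ne_zero.mpr hp.2)).contDiffWithinAt
    have h := ((hAc.inner ℝ hsub).div hnorm fun p hp => norm_ne_zero_iff.mpr (sub_ne_zero.mpr hp.2)).add hRc
    exact h
  -- (E1) from the evolution stub
  have hE1 := Antidynamo.stub_potentialEvolution v x₀ T hVS hTs hcpl'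
  -- the moment bound from the vorticity bound
  have hKA : ∀ t ∈ Iio (0 : ℝ), ∀ r > 0, ‖A t r‖ ≤ K := by
    intro t ht r hr
    obtain ⟨e, he, heA⟩ := NetFlux.exists_unit_orth (A t r)
    have hne : x₀ + r • e ≠ x₀ := by
      intro h; have : r • e = 0 := by simpa using h
      rw [smul_eq_zero] at this
      rcases this with h1 | h1
      · exact hr.ne' h1
      · rw [h1, norm_zero] at he; exact zero_ne_one he
    have hc := hcpl t ht (x₀ + r • e) hne
    rw [add_sub_cancel_left, cross_gradient_dipole_sphere (fun z => rfl) (hAt t ht) (hRt t ht) hr he] at hc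
    have hsq := norm_cross_sq (A t r) e
    rw [he, real_inner_comm, heA] at hsq
    have hn : ‖cross (A t r) e‖ = ‖A t r‖ := by
      have h1 : ‖cross (A t r) e‖ ^ 2 = ‖A t r‖ ^ 2 := by rw [hsq]; ring
      exact (sq_eq_sq₀ (norm_nonneg _) (norm_nonneg _)).mp h1
    rw [← hn, ← hc]
    exact hK t ht _
  -- C2: the moment vanishes identically
  have hA0 : ∀ t ∈ Iio (0 : ℝ), ∀ r > 0, A t r = 0 :=
    dipolarWindowIrrotational (Iio 0) v x₀ A R K isOpen_Iio hv2 hdiv hA3 hR3 hKA (fun t ht x hx => hcpl t ht x hx)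
      (fun t ht x hx => hE1 t ht x hx)
  -- hence the flow is irrotational, hence constant on each slice
  have hcurl0 : ∀ t < 0, ∀ x, curl (v t) x = 0 := by
    intro t ht x
    by_cases hx : x = x₀
    · rw [hx]; exact curl_centre_eq_zero_of_dipoleCoupling (hv1 t ht) (hAt t ht) (hRt t ht) (hcpl t ht)
    · have hr : 0 < ‖x - x₀‖ := norm_pos_iff.mpr (sub_ne_zero.mpr hx)
      obtain ⟨κ, hκ⟩ := dipole_gradient_sphere (x₀ := x₀) (T := T t) (fun z => rfl) (hAt t ht) (hRt t ht) hr
        (rfl : ‖x - x₀‖ = ‖x - x₀‖)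
      rw [add_sub_cancel] at hκ
      rw [hcpl' t ht x, hκ, hA0 t ht _ hr, smul_zero, zero_add, cross_smul_left, PointSource.cross_self, smul_zero]
  exact Antidynamo.stub_constantOfIrrotational v hB hsm hcurl0

end Summit.NavierStokesRegularity.NavierStokesRegularity.Theorems.PoloidalLiouville.FluxStarvedDipole

end
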